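import Summits.AtomisticToContinuum.HydrodynamicLimit.Theses.EinsteinBathSolvent
import Literature.MathematicalPhysics.KineticTheory.HardSphereEulerProofs

/-!
# Birth skeleton — crux `BathRemoval` (stmt-AtomisticToContinuum-17598), route EinsteinBathSolvent, line `birth`

`BathRemoval` (crux, rank 3; "removal of a thermodynamically negligible solvent"): there is a packing
threshold `η₀ > 0` such that for every bath window `0 < a < 1/3`, `0 < b < 2/3 − 2a`, every reduced
density `σ ∈ (0,1)`, continuous profiles, hard-sphere flows `Φ_N` and every guarded classical hs-Euler
solution on `[0,T)` matched by the local Gibbs fields at `t = 0`: IF for EVERY family of sphere–point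
mixture flows `Ψ_N` (`N+1` spheres of diameter `ε_N = σ(N+1)^{-1/3}` and mass `1`, `K_N = ⌊(N+1)^{1-a}⌋`
ideal points of mass `m_N = (N+1)^{-b}`) and every `t ∈ [0,T)` the SPHERE fields of the bathed gas converge
in probability (joint law `P_N` = localGibbs ⊗ conditioned ideal light bath) to the Euler values, THEN the
bare hard-sphere fields converge too (`TendstoHydroFieldsAt localGibbsLaw Φ ρ u θ t`).

## Idea of the line (the route's "R2–R3: removal of a vanishing solvent", typed along its three uses)

The hypothesis is consumed at ONE mixture flow, so the proof has exactly three ingredients, each a stub: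

1. CONSTRUCTION (`stub_spherePointFlow`): a sphere–point mixture flow exists for every `N` — the
   sphere–point Alexander theorem on `𝕋³`. The crux is typed at every `σ < 1`, so the statement is needed
   for sphere diameters `e = ε_N ∈ (0,1)`, not only `e < 1/2`: for `N ≥ 7` (`ε_N ≤ σ/2 < 1/2`) it is the
   route's support item `MixedFlowExists` (stmt-AtomisticToContinuum-13862) verbatim; the residual corner
   `N ≤ 6`, `ε_N ∈ [1/2, 1)` is the same a.e. construction with the minimal-image ambiguity set of the
   torus contact condition Liouville-null (and an empty mixture domain, hence a trivial inhabitant, once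
   `ε_N > √3/2` with two or more spheres). Without an inhabitant at EVERY `N` the Π-typed hypothesis
   `∀ Ψ : (N : ℕ) → MF …` cannot be instantiated and the crux would collapse onto the bare conjunct.
2. STATICS (`stub_bathMarginal`, SHARED verbatim — it IS the route's support item `BathMarginalExact`,
   stmt-AtomisticToContinuum-11941, provable-now): the bath is statically invisible — the sphere marginal of
   `P_N` is EXACTLY `localGibbsLaw` (disjoint exclusion balls of radius `ε_N/2 < 1/2`, excluded volume
   `(N+1)(π/6)ε_N³ = πσ³/6` configuration-independent, each light factor integrates to `1`).
3. DYNAMICS (`stub_solventInsensitivity`, the load-bearing stub): DYNAMIC SOLVENT INSENSITIVITY under the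
   NATURAL COUPLING — for `z ~ P_N` compare the sphere fields of the bathed evolution `SPH(Ψ_N(t) z)` with
   the bare evolution `Φ_N(t)(SPH z)` of the SAME sphere data: their `χ`-tested density / momentum / energy
   fields differ by more than `δ` only with `P_N`-probability `→ 0`, at every `t` of the guarded classical
   window `[0,T)`. Physically: a solvent carrying an `O(N^{-a})` fraction of energy / pressure / momentum
   flux, whose kicks randomise an `O(N^{-a-b/2}) → 0` fraction of each sphere's momentum per collision
   time, does not change the MACROSCOPIC fields realisation by realisation, although it decorrelates the
   microstate within `O(log N)` collision times (Lyapunov rate `≍ N^{1/3}`): a statement about laws of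
   macroscopic fields, never about trajectories. It is Euler-free in its conclusion (no limit values
   appear) and symmetric in the two dynamics; the pre-shock window is kept because beyond the classical
   time macroscopic non-uniqueness (spontaneous stochasticity) could let the two dynamics select different
   weak solutions.

COMPOSITION (`BathRemoval_of`, kernel-checked, ≈ 45 lines + two measure-theoretic lemmas): `η₀ :=` the
threshold of stub 3; choose `Ψ_N` by stub 1 (`Classical.choice` at every `N`, parameters positive since
`0 < ε_N ≤ σ < 1`, `m_N > 0`); read the crux's hypothesis at `Ψ` and stub 3 at `Ψ` with margin `δ/2`; by
stub 2, `LG_N(B) = P_N(SPH⁻¹ B)` for the (measurable) bare deviation event `B` (`Measure.map_apply`;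
measurability of the empirical fields against a continuous `χ` and of `Φ_N(t)`); the triangle inequality
gives `SPH⁻¹ B ⊆ {bathed deviation > δ/2} ∪ {coupling discrepancy > δ/2}` (`measure_dev_le_add`), and a
squeeze in `ℝ≥0∞` (`tendsto_zero_of_le_add`) ends the proof, for each of the three fields (`E = ℝ`, `V3`,
`ℝ`). The crux's hypothesis is CONSUMED (at `Ψ`); the Euler structure passes through untouched, as it must:
removing the bath has nothing to do with the Euler equations.

## Stubs (3; `sorry` lives only in §3)

| stub | statement | size / status |
|---|---|---|
| `stub_spherePointFlow` | `SpherePointFlowExists`: `∀ n k e μ, 0<e<1 → 0<μ → Nonempty (MixFlow n k e μ)` | L (Alexander / Vaserstein–BFK; = MixedFlowExists off the corner `e ≥ 1/2`) |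
| `stub_bathMarginal` | `EinsteinBathSolvent.BathMarginalExact` BY NAME (support item stmt-11941) | M, provable-now; SHARED — one proof closes both |
| `stub_solventInsensitivity` | `SolventInsensitivity` (coupling form, pre-shock window, all `(a,b)` in the window, `σ<1`) | XL, HARDEST — conjunct-complete given `EinsteinBathEuler`, exactly as the crux's own why-might-fail says |

## Disproof / negatives used

No `Disproof.lean` and no workfile existed for this crux at registration (`ledger crux ls`, 2026-08-17).
`ledger negatives --problem AtomisticToContinuum` (20 entries; on this sub: TwoClocks clamped/capped window
LD, StrongClosureWeakBV, JeansLoadedDice contact-intensity domination, WarmCold* degenerate parameters,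
EnskogAdjointDuality test family, EulerCharacteristics tail budget, AnosovDiceHopf construction,
SpectralContraction, BGEndpoint Lanford envelope): no stub is collisional-clamped, capped, or a
degenerate-parameter statement; stub 3 keeps the conjunct's t = 0 matching hypothesis and the packing
guard (`∃ η₀` outermost) exactly as the crux, so the WarmCold / Enskog degenerate-parameter witnesses do
not apply. Typing checklist 4c: no Bochner integral over an unconstrained `f` (all integrands are the
crux's own), no hand-picked threshold (margins are `δ/2` of an arbitrary `δ`).

## BC3 record (registrar seat planner-skel-stmt-AtomisticToContinuum-17598-0, 2026-08-17)

`lean check --json` rc 0, sorries = 3 = stubs (lines of `stub_spherePointFlow`, `stub_bathMarginal`,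
`stub_solventInsensitivity`), zero elsewhere; `#h21_check_skeleton` pre-check: ok, theorem `BathRemoval_of`,
codes []. Probes `stub → BathRemoval` and `stub → _root_.HydrodynamicLimit` by
`first | exact? | simpa | aesop` (maxHeartbeats 400000): FAILED 6/6 (unsolved goals; aesop exhaustive
search failed) — no stub is cheaply the crux or the summit.
-/

noncomputable section

open MeasureTheory Set Filter
open scoped ENNReal Topology

namespace Summit.AtomisticToContinuum.HydrodynamicLimit.Cruxes.BathRemoval.Birth

open Literature.Analysis.FluidPDE (Config HardSphereFlow PolydisperseHardSphereFlow localMaxwellian)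
open Literature.MathematicalPhysics.KineticTheory (T3 V3 hsDiameter localGibbsLaw
  empiricalDensityField empiricalMomentumField empiricalEnergyField totalEnergyDensity
  IsHardSphereEulerSolution TendstoHydroFieldsAt hsDiameter_pos hsDiameter_le
  empiricalDensityField_eq_sum empiricalMomentumField_eq_sum empiricalEnergyField_eq_sum)
open Summit.AtomisticToContinuum.HydrodynamicLimit.Theses.EinsteinBathSolvent (BathRemoval
  BathMarginalExact MixedFlowExists)

/-! ## §0 Vocabulary (abbreviations of the crux's `let` block; all unfold definitionally) -/

/-- Phase space of `n` particles on `𝕋³` (the crux's `CFG`). -/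
abbrev CFG (n : ℕ) : Type := Config n (Fin 3) T3

/-- The flat unit torus geometry (the crux's `G`). -/
abbrev G3 : Literature.Analysis.FluidPDE.Geometry (Fin 3) T3 :=
  Literature.Analysis.FluidPDE.Torus.geometry (Fin 3)

/-- The sphere–point mixture flow type: `n` spheres of mass `1` and diameter `e` together with `k`
point particles of mass `μ` and diameter `0` on `𝕋³` (verbatim the crux's `MF n k e μ`). -/
abbrev MixFlow (n k : ℕ) (e μ : ℝ) : Type :=
  PolydisperseHardSphereFlow G3 (Fin.append (fun _ : Fin n => (1 : ℝ)) (fun _ : Fin k => μ))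
    (Fin.append (fun _ : Fin n => e) (fun _ : Fin k => (0 : ℝ)))

/-- The joint initial law of the bathed gas: local Gibbs law of the `N+1` spheres ⊗ `k` i.i.d.
lights, uniform outside the exclusion balls and Maxwellian of mass `μ` at `θ₀(x)`, drift `u₀(x)`,
pushed to `CFG (N+1+k)` by `Fin.append` (verbatim the crux's `P N`, with general `k`, `μ`). -/
def bathLaw (σ : ℝ) (a₀ : T3 → ℝ) (u₀ : T3 → V3) (θ₀ : T3 → ℝ) (N k : ℕ) (μ : ℝ)
    (Φ : HardSphereFlow G3 (hsDiameter σ N) (N + 1)) : Measure (CFG (N + 1 + k)) :=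
  Measure.map (fun x : CFG (N + 1) × CFG k => (Fin.append x.1 x.2 : CFG (N + 1 + k)))
    (((localGibbsLaw σ a₀ u₀ θ₀ N Φ).prod volume).withDensity (fun x => ENNReal.ofReal
      (∏ j, (1 - Real.pi * σ ^ 3 / 6)⁻¹ *
        (if ∀ i, hsDiameter σ N / 2 < ‖G3.sepVec (x.2 j).1 (x.1 i).1‖ then (1 : ℝ) else 0) *
        localMaxwellian 1 (θ₀ (x.2 j).1 / μ) (u₀ (x.2 j).1) (x.2 j).2)))

/-- The sphere component of a mixture configuration (the crux's `SPH N`). -/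
abbrev sph (N k : ℕ) (z : CFG (N + 1 + k)) : CFG (N + 1) := fun i => z (Fin.castAdd k i)

/-- Number of lights `K_N = ⌊(N+1)^(1-a)⌋` (the crux's `K N`). -/
abbrev nLights (a : ℝ) (N : ℕ) : ℕ := ⌊((N : ℝ) + 1) ^ (1 - a)⌋₊

/-- Light mass `m_N = (N+1)^(-b)` (the crux's `m N`). -/
abbrev mLight (b : ℝ) (N : ℕ) : ℝ := ((N : ℝ) + 1) ^ (-b)

/-! ## §1 Stub statements (named `Prop`s) -/

/-- **Stub 1 statement — SPHERE–POINT MIXTURE FLOWS EXIST ON `𝕋³` (construction).** For all `n`, `k`,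
every sphere diameter `e ∈ (0,1)` and light mass `μ > 0` the hard-body mixture flow of `n` spheres (mass
`1`, diameter `e`) and `k` ideal points (mass `μ`, diameter `0`; contact distances `e`, `e/2`, `0`) on the
flat unit torus exists: `Nonempty (MixFlow n k e μ)`. Alexander's a.e. construction (collisions locally
finite for hard balls of arbitrary masses: Vaserstein 1979, Burago–Ferleger–Kononenko 1998, lifted
locally from `ℝ³`; template `HardSphereAlexander` / AMP 2022 Thm 3.1). For `e < 1/2` this is the route's
support item `MixedFlowExists` (stmt-AtomisticToContinuum-13862); the extension to `e ∈ [1/2, 1)` is forced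
by the crux's typing (`σ < 1`, small `N`) and changes nothing in the construction (minimal-image ties are
Liouville-null; for `e > √3/2` and `n ≥ 2` the mixture domain is empty and the structure is trivially
inhabited). Why it might fail: only through a positive-measure Zeno set for sphere–point mixtures, excluded
by the BFK collision bounds. Size L. -/
def SpherePointFlowExists : Prop :=
  ∀ (n k : ℕ) (e μ : ℝ), 0 < e → e < 1 → 0 < μ → Nonempty (MixFlow n k e μ)

/-- **Stub 3 statement — DYNAMIC SOLVENT INSENSITIVITY of the sphere fields under the natural coupling,
before the first shock (the load-bearing stub).** Frame verbatim the crux's (threshold `η₀` outermost,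
window `(a,b)`, `σ ∈ (0,1)`, continuous positive profiles, hard-sphere flows `Φ_N`, a classical hs-Euler
solution on `[0,T)` obeying the packing guard and matched by the local Gibbs fields at `t = 0`); claim: for
EVERY family of mixture flows `Ψ_N`, every `t ∈ [0,T)`, continuous `χ` and `δ > 0`, the `P_N`-probability
that the `χ`-tested empirical density (resp. momentum, energy) field of the sphere component of the BATHED
configuration `Ψ_N(t) z` differs by more than `δ` from that of the BARE evolution `Φ_N(t)(SPH z)` of the same
sphere data tends to `0`. Why plausibly true: the solvent's energy / pressure / momentum-flux content is
`O(N^{-a})`, its heat transport `O(N^{-2a})`, its randomisation `O(N^{-a-b/2})` per collision time, and both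
gases are expected to be macroscopically deterministic before the first shock. Why it might fail: it is
conjunct-complete given `EinsteinBathEuler` (if the bare gas were not hydrodynamic the coupling discrepancy
would be `O(1)`), and no law-level stability of Euler-scale fields under an `o(1)`-per-collision
conservative perturbation is known (cf. `VanishingNoise.DiceContinuity`); pathwise coupling is hopeless
(Lyapunov rate `≍ N^{1/3}`). Sources: OllaVaradhanYau1993 §2.1; Spohn1991 §8.4; KusuokaLiang2010;
arXiv:2310.13338. Size XL. -/
def SolventInsensitivity : Prop :=
  ∃ η₀ : ℝ, 0 < η₀ ∧ ∀ (a b : ℝ), 0 < a → a < 1 / 3 → 0 < b → b < 2 / 3 - 2 * a →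
    ∀ σ : ℝ, 0 < σ → σ < 1 →
    ∀ (a₀ θ₀ : T3 → ℝ) (u₀ : T3 → V3), Continuous a₀ → Continuous θ₀ → Continuous u₀ →
      (∀ x, 0 < a₀ x) → (∀ x, 0 < θ₀ x) →
    ∀ Φ : (N : ℕ) → HardSphereFlow G3 (hsDiameter σ N) (N + 1),
    ∀ (T : ℝ) (ρ θ : ℝ → T3 → ℝ) (u : ℝ → T3 → V3), IsHardSphereEulerSolution σ T ρ u θ →
      (∀ t ∈ Ico 0 T, ∀ x, ρ t x * σ ^ 3 < η₀) →
      TendstoHydroFieldsAt (fun N => localGibbsLaw σ a₀ u₀ θ₀ N (Φ N)) Φ ρ u θ 0 →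
    ∀ Ψ : (N : ℕ) → MixFlow (N + 1) (nLights a N) (hsDiameter σ N) (mLight b N),
    ∀ t ∈ Ico 0 T, ∀ χ : T3 → ℝ, Continuous χ → ∀ δ : ℝ, 0 < δ →
      Tendsto (fun N => bathLaw σ a₀ u₀ θ₀ N (nLights a N) (mLight b N) (Φ N)
          {z | δ < |empiricalDensityField (sph N (nLights a N) ((Ψ N).flow t z)) χ -
            empiricalDensityField ((Φ N).flow t (sph N (nLights a N) z)) χ|}) atTop (𝓝 0) ∧
      Tendsto (fun N => bathLaw σ a₀ u₀ θ₀ N (nLights a N) (mLight b N) (Φ N)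
          {z | δ < ‖empiricalMomentumField (sph N (nLights a N) ((Ψ N).flow t z)) χ -
            empiricalMomentumField ((Φ N).flow t (sph N (nLights a N) z)) χ‖}) atTop (𝓝 0) ∧
      Tendsto (fun N => bathLaw σ a₀ u₀ θ₀ N (nLights a N) (mLight b N) (Φ N)
          {z | δ < |empiricalEnergyField (sph N (nLights a N) ((Ψ N).flow t z)) χ -
            empiricalEnergyField ((Φ N).flow t (sph N (nLights a N) z)) χ|}) atTop (𝓝 0)

/-! ## §2 The stub statements BY STUB NAME (device of the sibling birth skeletons: the native
skeleton audit admits a hypothesis of the composing theorem iff its head constant is a registered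
obligation or is NAMED like a declared stub; `@[stub]` being gate-reserved, each statement is
mirrored by an alias in the implementation-detail namespace `__Registered`). -/
namespace __Registered

/-- Alias of `SpherePointFlowExists`, keyed by the registered name `stub_spherePointFlow`. -/
abbrev stub_spherePointFlow : Prop := SpherePointFlowExists

/-- Alias of the route's support item `BathMarginalExact`, keyed by `stub_bathMarginal`. -/
abbrev stub_bathMarginal : Prop := BathMarginalExact

/-- Alias of `SolventInsensitivity`, keyed by the registered name `stub_solventInsensitivity`. -/
abbrev stub_solventInsensitivity : Prop := SolventInsensitivity

end __Registered

/-! ## §3 The registered stubs (`sorry` lives ONLY here) -/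

/-- STUB 1 (construction, L): sphere–point mixture flows on `𝕋³`. -/
theorem stub_spherePointFlow : SpherePointFlowExists := by
  sorry

/-- STUB 2 (SHARED with support item stmt-AtomisticToContinuum-11941, provable-now): the bath is
statically invisible — the sphere marginal of the bathed initial law is the local Gibbs law. -/
theorem stub_bathMarginal : BathMarginalExact := by
  sorry

/-- STUB 3 (hardest, XL): dynamic solvent insensitivity before the first shock. -/
theorem stub_solventInsensitivity : SolventInsensitivity := by
  sorry

example : __Registered.stub_spherePointFlow := stub_spherePointFlow
example : __Registered.stub_bathMarginal := stub_bathMarginal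
example : __Registered.stub_solventInsensitivity := stub_solventInsensitivity

/-! ## §4 Glue (sorry-free) -/

/-- The sphere projection is measurable. -/
theorem measurable_sph (N k : ℕ) : Measurable (sph N k) :=
  measurable_pi_lambda _ fun _ => measurable_pi_apply _

/-- Empirical density field against a continuous `χ`: measurable in the configuration. -/
theorem measurable_densityField {n : ℕ} {χ : T3 → ℝ} (hχ : Continuous χ) :
    Measurable fun z : CFG n => empiricalDensityField z χ := by
  have h : (fun z : CFG n => empiricalDensityField z χ) = fun z => ((n : ℕ) : ℝ)⁻¹ * ∑ i, χ (z i).1 :=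
    funext fun z => empiricalDensityField_eq_sum z χ
  rw [h]
  exact measurable_const.mul
    (Finset.measurable_sum _ fun i _ => hχ.measurable.comp (measurable_pi_apply i).fst)

/-- Empirical momentum field against a continuous `χ`: measurable in the configuration. -/
theorem measurable_momentumField {n : ℕ} {χ : T3 → ℝ} (hχ : Continuous χ) :
    Measurable fun z : CFG n => empiricalMomentumField z χ := by
  have h : (fun z : CFG n => empiricalMomentumField z χ) =
      fun z => ((n : ℕ) : ℝ)⁻¹ • ∑ i, χ (z i).1 • (z i).2 :=
    funext fun z => empiricalMomentumField_eq_sum z χ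
  rw [h]
  have hsum : Measurable fun z : CFG n => ∑ i, χ (z i).1 • (z i).2 :=
    Finset.measurable_sum Finset.univ fun i _ =>
      (hχ.measurable.comp (measurable_pi_apply i).fst).smul (measurable_pi_apply i).snd
  exact hsum.const_smul (((n : ℕ) : ℝ)⁻¹)

/-- Empirical energy field against a continuous `χ`: measurable in the configuration. -/
theorem measurable_energyField {n : ℕ} {χ : T3 → ℝ} (hχ : Continuous χ) :
    Measurable fun z : CFG n => empiricalEnergyField z χ := by
  have h : (fun z : CFG n => empiricalEnergyField z χ) =
      fun z => ((n : ℕ) : ℝ)⁻¹ * ∑ i, χ (z i).1 * (‖(z i).2‖ ^ 2 / 2) :=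
    funext fun z => empiricalEnergyField_eq_sum z χ
  rw [h]
  refine measurable_const.mul (Finset.measurable_sum _ fun i _ => ?_)
  have hx : Measurable fun z : CFG n => χ (z i).1 := hχ.measurable.comp (measurable_pi_apply i).fst
  have hv : Measurable fun z : CFG n => ‖(z i).2‖ ^ 2 / 2 := by fun_prop
  exact hx.mul hv

/-- **Union bound through an exact marginal.** If `Q` is the `π`-marginal of `P`, the `Q`-probability
that a measurable observable `F` deviates from `c` by more than `δ` is at most the `P`-probability
that `G` deviates from `c` by more than `δ/2` plus the `P`-probability that `G` and `F ∘ π` differ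
by more than `δ/2`. -/
theorem measure_dev_le_add {α β E : Type*} [MeasurableSpace α] [MeasurableSpace β]
    [NormedAddCommGroup E] [MeasurableSpace E] [OpensMeasurableSpace E]
    {P : Measure α} {Q : Measure β} {π : α → β} (hπ : Measurable π) (hQ : Measure.map π P = Q)
    {F : β → E} (hF : Measurable F) (G : α → E) (c : E) (δ : ℝ) :
    Q {y | δ < ‖F y - c‖} ≤ P {x | δ / 2 < ‖G x - c‖} + P {x | δ / 2 < ‖G x - F (π x)‖} := by
  have hO : IsOpen {e : E | δ < ‖e - c‖} :=
    isOpen_lt continuous_const (continuous_norm.comp (continuous_id.sub continuous_const))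
  have hB : MeasurableSet {y | δ < ‖F y - c‖} := hF hO.measurableSet
  rw [← hQ, Measure.map_apply hπ hB]
  refine (measure_mono ?_).trans (measure_union_le _ _)
  intro x hx
  simp only [Set.mem_preimage, Set.mem_setOf_eq, Set.mem_union] at hx ⊢
  by_contra h
  rw [not_or, not_lt, not_lt] at h
  have : ‖F (π x) - c‖ ≤ δ :=
    calc ‖F (π x) - c‖ = ‖(G x - c) - (G x - F (π x))‖ := by congr 1; abel
      _ ≤ ‖G x - c‖ + ‖G x - F (π x)‖ := norm_sub_le _ _
      _ ≤ δ / 2 + δ / 2 := add_le_add h.1 h.2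
      _ = δ := by ring
  exact absurd hx (not_lt.2 this)

/-- Squeeze: a sequence in `ℝ≥0∞` dominated termwise by the sum of two null sequences is null. -/
theorem tendsto_zero_of_le_add {u v w : ℕ → ℝ≥0∞} (h : ∀ N, u N ≤ v N + w N)
    (hv : Tendsto v atTop (𝓝 0)) (hw : Tendsto w atTop (𝓝 0)) : Tendsto u atTop (𝓝 0) := by
  have hvw : Tendsto (fun N => v N + w N) atTop (𝓝 0) := by simpa using hv.add hw
  exact tendsto_of_tendsto_of_tendsto_of_le_of_le tendsto_const_nhds hvw (fun _ => zero_le) h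

/-- **THE SKELETON THEOREM** — the three registered stubs imply the crux BY NAME. -/
theorem BathRemoval_of :
    __Registered.stub_spherePointFlow → __Registered.stub_bathMarginal →
      __Registered.stub_solventInsensitivity → BathRemoval := by
  intro hF hM hS
  obtain ⟨η₀, hη₀, hS'⟩ := hS
  refine ⟨η₀, hη₀, ?_⟩
  intro a b ha1 ha2 hb1 hb2 σ hσ hσ1 ε a₀ θ₀ u₀ ha hθ hu ha0 hθ0 Φ K m Tz LG P SPH T ρ θ u hEu hG h0 H
    t ht
  -- positivity of the parameters of the mixture at every `N`
  have hεpos : ∀ N : ℕ, 0 < hsDiameter σ N := fun N => hsDiameter_pos hσ N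
  have hεlt : ∀ N : ℕ, hsDiameter σ N < 1 := fun N => (hsDiameter_le hσ.le N).trans_lt hσ1
  have hm : ∀ N : ℕ, 0 < mLight b N := fun N => Real.rpow_pos_of_pos (by positivity) _
  -- STUB 1: choose a family of sphere–point mixture flows
  let Ψ : (N : ℕ) → MixFlow (N + 1) (nLights a N) (hsDiameter σ N) (mLight b N) := fun N =>
    Classical.choice (hF (N + 1) (nLights a N) (hsDiameter σ N) (mLight b N) (hεpos N) (hεlt N) (hm N))
  -- the crux's hypothesis at `Ψ`, and STUB 3 at `Ψ`
  have HΨ := H Ψ t ht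
  have hSΨ := hS' a b ha1 ha2 hb1 hb2 σ hσ hσ1 a₀ θ₀ u₀ ha hθ hu ha0 hθ0 Φ T ρ θ u hEu hG h0 Ψ t ht
  -- STUB 2: the sphere marginal of the bathed initial law is the local Gibbs law
  have hmarg : ∀ N : ℕ, Measure.map (sph N (nLights a N))
      (bathLaw σ a₀ u₀ θ₀ N (nLights a N) (mLight b N) (Φ N)) = localGibbsLaw σ a₀ u₀ θ₀ N (Φ N) :=
    fun N => hM σ hσ hσ1 a₀ θ₀ u₀ ha hθ hu ha0 hθ0 N (nLights a N) (mLight b N) (hm N) (Φ N)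
  intro χ hχ δ hδ
  obtain ⟨H1, H2, H3⟩ := HΨ χ hχ (δ / 2) (half_pos hδ)
  obtain ⟨S1, S2, S3⟩ := hSΨ χ hχ (δ / 2) (half_pos hδ)
  refine ⟨?_, ?_, ?_⟩
  · exact tendsto_zero_of_le_add (fun N => measure_dev_le_add (E := ℝ) (measurable_sph N _) (hmarg N)
      ((measurable_densityField hχ).comp ((Φ N).measurable_flow t))
      (fun z => empiricalDensityField (sph N (nLights a N) ((Ψ N).flow t z)) χ) _ δ) H1 S1
  · exact tendsto_zero_of_le_add (fun N => measure_dev_le_add (E := V3) (measurable_sph N _) (hmarg N)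
      ((measurable_momentumField hχ).comp ((Φ N).measurable_flow t))
      (fun z => empiricalMomentumField (sph N (nLights a N) ((Ψ N).flow t z)) χ) _ δ) H2 S2
  · exact tendsto_zero_of_le_add (fun N => measure_dev_le_add (E := ℝ) (measurable_sph N _) (hmarg N)
      ((measurable_energyField hχ).comp ((Φ N).measurable_flow t))
      (fun z => empiricalEnergyField (sph N (nLights a N) ((Ψ N).flow t z)) χ) _ δ) H3 S3

/-- Wiring check: the three registered stubs fill the three hypotheses (depends on their `sorry`,
declares none). -/
example : BathRemoval := BathRemoval_of stub_spherePointFlow stub_bathMarginal stub_solventInsensitivity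

end Summit.AtomisticToContinuum.HydrodynamicLimit.Cruxes.BathRemoval.Birth

end
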